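import Summits.QuantumFields.YangMills.Theorems.BalabanUVNodesN08AlphaEq324RowClassSocketEndIndexed
import Literature.MathematicalPhysics.QuantumFieldTheory.Balaban1983to89.B1Eq324BenfattoClassTorusGaugeFluctuation

/-!
# Route «BalabanUVNodes», Track-A DAG node N08 = [Balaban1985UV3] Thm 1 p. 257 ∕ Thm 2 p. 272 — THE (α)-SOCKET AT A PRINTED MEMBER, NO MEMBER HYPOTHESIS LEFT:
# the (3.24) row `h324` of the edited clauses at EVERY run step for an a.e. presentation of the step block by the ZERO-BACKGROUND GAUGE-FIELD FLUCTUATION GAUSSIAN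
# `𝒩(0, (Cᵀ·Re Δ_k·C)⁻¹)` of [Balaban1984PropagatorsII] (2.152)–(2.157) on ANY sub-family of the free bond variables of ANY cubic torus `(ℤ∕N)^{d_T}` at ANY level —
# [Balaban1985UV3] (22)∕(58) at the trivial background `U_{k+1} = 1` (part 10 of the class socket)

Cell `pub-ymgap`, seat `pub-ymgap-dag-n08-w4` gen 6 (CLAIM-5 ∕ INTENT-5).  `bears_on: R4∕N08`; filed `--supports stmt-QuantumFields-27364` (K1⁹, helper).  THEOREMS ONLY
(def-free, sorry-free, standard axioms); seat n08-d's `…ClassTorusGaugeFluctuation.eq324_torusGaugeFluctuationSub_on_unit` (gen 16, p645592; over cell pub-balaban's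
`B6Cov2156TorusDelK` ∕ `B6Cov2156TorusSubset` and n08-b's bent window), part 4's `…ClassSocketApprox.h324Row_freeLetter_of_postConsumer_ae` (p636897) and part 8's
`…ClassSocketEndIndexed.preimage_box_ae_eq_smallFieldSet_of_nonneg` consumed BY NAME.

WHY.  Parts 8–9 put the socket's mouth at the block's own torus-indexed variables with the member rows DISPLAYED (N06's content at a general background).  At the
TRIVIAL background — [Balaban1985UV3] (22) p.261 at the first step, (58) p.270 at `U_{k+1} = 1` — the member is a PRINTED object the tree holds hypothesis-free:
[Balaban1984PropagatorsII] pp. 249–250 *«∫dB δ(QB) δ_{Ax}(B) e^{−½⟨B,Δ_kB⟩} F(B) (2.152) on the whole lattice T^{(k)} … B = CB′ … e^{−½⟨B′,C*Δ_kCB′⟩} … (2.155) …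
⟨B′, C*Δ_kCB′⟩ ≥ γ′₀‖B′‖² (2.157)»*, certified by cell pub-balaban's lineage (`reDelK`, `kernelDecay_reDelK`, `ineq_2157_reDelK_sharp`, the explicit elimination
matrix `elimTS` on a sub-family) and run through the class road by seat n08-d (`eq324_torusGaugeFluctuationSub_on_unit`, p645592: every `d_T ≥ 2`, every block size
`L_T ≥ 1`, every cubic torus with `L_T ∣ N`, every level `n ≥ 1`, every nonempty sub-family `S ⊆ B′` of the free bond variables — NO displayed member input).  This part is
the Summits-side consumption: a `StepSeries` block presented by THAT Gaussian ⟹ `StepAlphaEq324CoreLTAtAC.h324` ∕ `…CoreLTAt.h324` at the free letter, every run step.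
What is left of row `h324` at the trivial background is then ONLY the IDENT's class-II half: NODE 00's identification of `(𝔖 k).μ ∕ box ∕ 𝒱` at `U_{k+1} = 1` with this
Gaussian on the variables of `Ω_{k+1}(h)` (`Φ`, `hμ`, `hbox`, `hV`), the Hamiltonian letters on the bent window, the window `b₁ < b₀`, the budget.
* §1 ★★★★★ `exists_threshold_h324Row_freeLetter_of_torusGaugeFluctuationPresentation_allSteps_ae` — `∀ d_T ≥ 2, L_T ≥ 1`: `∃ b₁ ∀ b₀ > b₁ ∃ C ≥ 0 ∀ S ∀ k ≤ K ∀ v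
  (C·v ≤ Ca + Cc) ∀ N (L_T ∣ N) ∀ n ≥ 1 ∀ (Bv : per-(h,U) nonempty sub-families of the free bond variables B′ = freeT L_T N)`, `∃ (Λ, e)` on the bent window `ℤ^{2d_T+1}`
  (chosen per (h,U), BEFORE the tower data) such that for EVERY `𝔖` and EVERY measurable `Φ h U : (Bv h U → ℝ) → Fl` with `(𝔖 k).μ = 𝒩(0, (C_Sᵀ·Re Δ_k·C_S)⁻¹).map Φ`, `Φ⁻¹'box =ᵐ {|ω_b| ≤ p(g_k) ∀ b}`,
  `𝒱 ∘ Φ =ᵐ H`, `H (z ∘ e) = H^{aw}_{Jw} z` (`Jw ⊆ Λ`, `sup|coeff| ≤ c₀ g_k^σ`), `|Bv h U| ≤ v·|T₁^{(k)}|` gives `h324` — member side UNCONDITIONAL.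
* §2 ★★★★★★ `eq324_torusGaugeDatum_allSteps` — THE PIPELINE FIRES, UNCONDITIONALLY: for every `S`, `k ≤ K`, cubic torus, level, nonempty sub-family `B ⊆ B′` under the budget
  `C·|B| ≤ (Ca + Cc)·|T₁^{(k)}|`: `∃ (Λ, e)`, for every (4.5)-polynomial `H^a_J` on the window (`J ⊆ Λ`, `sup|coeff| ≤ c₀ g_k^σ`) read through `e`:
  `Eq324 (∫_{Πχ̂} e^{H} d𝒩(0,(C_Bᵀ·Re Δ_k·C_B)⁻¹)) (free cumulants) n̄ (Ca + Cc) (Lᵏg₀²) (3 + κ₀) |T₁^{(k)}|` = the field `StepAlphaEq324CoreLTAtAC.h324` of the literal tower datum with that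
  block — the class road ∘ (α)-socket pipeline exercised END TO END on a printed object; only the window `b₁ < b₀` and the budget are displayed (A6 for §1 included).
HONEST SCOPE.  A composition by name (`choose` over n08-d's capstone, `Measure.map_map`, `QuasiMeasurePreserving.preimage_ae_eq`, `ae_eq_comp`, part 4's plug); ZERO BACKGROUND ONLY
— at a general background `U_{k+1}` the member rows are N06's ([Balaban1985BackgroundPropagators] Sect. E) content, displayed in part 9; the junction to NODE 00's
`(𝔖 k).μ ∕ box ∕ 𝒱` (is [Balaban1985UV3]'s `dμ_{C^{(k)}}` at `U_{k+1} = 1` this Gaussian on the variables of `Ω_{k+1}(h)`? — lit-balaban r07's `B10Eq55GaussianStep.gaussMeasure`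
and seat n08-b's CLAIM-2 `B10Eq55GaussianStepPresentation` are the typed road to that sentence) is THE IDENT — NOT made, NOT commissioned, NOT claimed; nothing of [Balaban1985UV3]
∕ [BenfattoEtAl1978] ∕ [Balaban1984PropagatorsII] asserted beyond what cell pub-balaban proved; `PrintedUV3V` NOT proved; N08 NOT discharged; count-neutral; one finite 𝕋⁴
programme at fixed ε — R4 closes the conditional finite-𝕋⁴ rung `BalabanLadder.UV` only; nothing continuum ∕ ℝ⁴ ∕ OS ∕ mass gap ∕ Clay.
-/

noncomputable section

namespace Summit.QuantumFields.YangMills.Theorems.BalabanUVNodesN08AlphaEq324RowClassSocketEndTorusGauge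

open MeasureTheory
open scoped BigOperators Nat Matrix
open Literature.MathematicalPhysics.QuantumFieldTheory (gaussianFieldOfKernel)
open Literature.MathematicalPhysics.QuantumFieldTheory.Balaban1983to89
open Literature.MathematicalPhysics.QuantumFieldTheory.Balaban1983to89.B1Sect3Statements (Eq324)
open Literature.MathematicalPhysics.QuantumFieldTheory.Balaban1983to89.B1Eq324BenfattoLemma (Coef hamiltonian coefSup smallFieldSet)
open Literature.MathematicalPhysics.QuantumFieldTheory.Balaban1983to89.B1Eq324BenfattoClassPresentation (measurable_restrictAlong)
open Literature.MathematicalPhysics.QuantumFieldTheory.Balaban1983to89.B1Eq324BenfattoSect5Eq515 (hamiltonian_congr_eqOn)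
open Literature.MathematicalPhysics.QuantumFieldTheory.Balaban1983to89.B6Lemma24Torus (pbox)
open Literature.MathematicalPhysics.QuantumFieldTheory.Balaban1983to89.B6Cov2156Torus (freeT)
open Literature.MathematicalPhysics.QuantumFieldTheory.Balaban1983to89.B6Cov2156TorusSubset (elimTS)
open Literature.MathematicalPhysics.QuantumFieldTheory.Balaban1983to89.B6Cov2156TorusDelK (reDelK)
open Literature.MathematicalPhysics.QuantumFieldTheory.Balaban1983to89.B1Eq324BenfattoClassTorusGaugeFluctuation (eq324_torusGaugeFluctuationSub_on_unit)
open Literature.MathematicalPhysics.QuantumFieldTheory.Balaban1985CMP102.Setting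
open Summit.QuantumFields.Balaban3D.Carriers
open Summit.QuantumFields.Balaban3D.Proofs.ScalesArithmetic (gk_pos gk_le_one sites_pos)
open Summit.QuantumFields.Balaban3D.Proofs.Primitives (AlphaConsts)
open Summit.QuantumFields.Balaban3D.Proofs.GroupModelLieC (lieC)
open Summit.QuantumFields.YangMills.Theorems.BalabanUVNodesN08AlphaEq324RowClassSocketApprox (h324Row_freeLetter_of_postConsumer_ae)
open Summit.QuantumFields.YangMills.Theorems.BalabanUVNodesN08AlphaEq324RowClassSocketEndIndexed (preimage_box_ae_eq_smallFieldSet_of_nonneg)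
open Literature.Probability.LatticeModels (cumulantOf)

variable {L : ℕ} {G : Type} [GaugeGroup G] [MeasurableSpace G] [HaarData G] (𝔊 : GroupModel G) (𝔠 : AlphaConsts L 𝔊.N)

/-- ★★★★★ **ROW `h324` AT EVERY RUN STEP FROM A PRESENTATION BY THE PRINTED ZERO-BACKGROUND GAUGE-FIELD FLUCTUATION GAUSSIAN `𝒩(0, (C_Sᵀ·Re Δ_k·C_S)⁻¹)` — MEMBER SIDE
UNCONDITIONAL** (statement in the module docstring).  `b₁` depends on `(d_T, L_T, D, ϰ, p₀, σ, c₀, n̄, κ₀)` only; for `b₀ > b₁` the constant `C` on those and `b₀`; the torus size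
`N` (`L_T ∣ N`) and the level `n` are per step, the sub-family `Bv h U ⊆ B′` per `(h, U)`.
[cite: Balaban1985UV3, (22) p.261 + (58) p.270; Balaban1984PropagatorsII, (2.152)–(2.157) pp.249–250; Balaban1982Higgs1, (3.24) p.616; BenfattoEtAl1978, Lemma p.152 (class form; ours)] -/
theorem exists_threshold_h324Row_freeLetter_of_torusGaugeFluctuationPresentation_allSteps_ae {dT LT : ℕ} (hdT : 2 ≤ dT) (hLT : 1 ≤ LT)
    (D : ℕ) {ϰ : ℝ} (hϰ : 0 < ϰ) {p₀ σ c₀ : ℝ} (hp₀ : 2 / 3 < p₀) (hσ : 0 < σ) (hc₀ : 0 ≤ c₀) (hκσ : 6 + 2 * 𝔠.κ₀ < σ * (𝔠.nbar + 1)) :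
    ∃ b₁ : ℝ, ∀ b₀ : ℝ, b₁ < b₀ → ∃ C : ℝ, 0 ≤ C ∧
      ∀ (S : Scales L) (k : ℕ), k ≤ S.K → ∀ (v : ℝ), C * v ≤ 𝔠.Ca + 𝔠.Cc →
        ∀ (N : ℕ) [NeZero N], LT ∣ N → ∀ (n : ℕ) (hn : 1 ≤ n)
          (Bv : Hist S.P (k + 1) → GaugeField S.P (k + 1) G → Finset (B4.Idx (pbox (fun _ : Fin dT => N)) dT))
          (hBv : ∀ h U, Bv h U ⊆ freeT LT (fun _ : Fin dT => N)), (∀ h U, (Bv h U).Nonempty) →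
        ∃ (Λ : Hist S.P (k + 1) → GaugeField S.P (k + 1) G → Finset (Fin (dT + dT + 1) → ℤ)) (e : ∀ h U, ↥(Bv h U) ≃ ↥(Λ h U)),
        ∀ (𝔖 : ∀ k, StepSeries S G ↥(lieC 𝔊) (nblkOf S 𝔠.lane.carrier k) k)
          (Φ : ∀ h U, (↥(Bv h U) → ℝ) → (𝔖 k).Fl) (H : ∀ h U, (↥(Bv h U) → ℝ) → ℝ)
          (s : ℕ) (Jw : Hist S.P (k + 1) → GaugeField S.P (k + 1) G → Finset (Fin (dT + dT + 1) → ℤ))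
          (aw : Hist S.P (k + 1) → GaugeField S.P (k + 1) G → Coef (dT + dT + 1)),
          -- the a.e. presentation by the zero-background gauge-field fluctuation Gaussian on the sub-family's own variables
          (∀ h U, Measurable (Φ h U)) →
          (∀ h U, (𝔖 k).μ = (gaussianFieldOfKernel fun b b' =>
            ((((elimTS LT (fun _ : Fin dT => N) (Bv h U) (hBv h U))ᵀ * reDelK n hn (fun _ : Fin dT => N) *
              elimTS LT (fun _ : Fin dT => N) (Bv h U) (hBv h U)))⁻¹ : Matrix ↥(Bv h U) ↥(Bv h U) ℝ) b b').map (Φ h U)) →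
          (∀ h, MeasurableSet ((𝔖 k).box h)) → (∀ h U, Measurable ((𝔖 k).𝒱 h U)) →
          (∀ h U, Φ h U ⁻¹' (𝔖 k).box h =ᵐ[gaussianFieldOfKernel fun b b' =>
            ((((elimTS LT (fun _ : Fin dT => N) (Bv h U) (hBv h U))ᵀ * reDelK n hn (fun _ : Fin dT => N) *
              elimTS LT (fun _ : Fin dT => N) (Bv h U) (hBv h U)))⁻¹ : Matrix ↥(Bv h U) ↥(Bv h U) ℝ) b b']
            {ω | ∀ b, |ω b| ≤ B10.pFun b₀ p₀ (S.gk k)}) →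
          (∀ h U, (fun ω => (𝔖 k).𝒱 h U (Φ h U ω)) =ᵐ[gaussianFieldOfKernel fun b b' =>
            ((((elimTS LT (fun _ : Fin dT => N) (Bv h U) (hBv h U))ᵀ * reDelK n hn (fun _ : Fin dT => N) *
              elimTS LT (fun _ : Fin dT => N) (Bv h U) (hBv h U)))⁻¹ : Matrix ↥(Bv h U) ↥(Bv h U) ℝ) b b'] H h U) →
          -- the Hamiltonian letters on the bent window (class II)
          (∀ h U (z : (Fin (dT + dT + 1) → ℤ) → ℝ), H h U (fun b => z ((e h U b : ↥(Λ h U)) : Fin (dT + dT + 1) → ℤ)) =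
            hamiltonian s D ϰ (aw h U) (Jw h U) z) →
          (∀ h U, Jw h U ⊆ Λ h U) → (∀ h U, coefSup s D (aw h U) (Jw h U) ≤ c₀ * S.gk k ^ σ) → (∀ h U, ((Bv h U).card : ℝ) ≤ v * S.sites k) →
          ∀ h (U : GaugeField S.P (k + 1) G),
            Eq324 (∫ ω in (𝔖 k).box h, Real.exp ((𝔖 k).𝒱 h U ω) ∂(𝔖 k).μ)
              (fun n => cumulantOf (fun m => ∫ ω, (𝔖 k).𝒱 h U ω ^ m ∂(𝔖 k).μ) n) 𝔠.nbar (𝔠.Ca + 𝔠.Cc)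
              ((L : ℝ) ^ k * S.g0sq) (3 + 𝔠.κ₀) (S.sites k) := by
  obtain ⟨b₁, hb₁⟩ := eq324_torusGaugeFluctuationSub_on_unit (d := dT) (L := LT) hdT hLT 𝔠.nbar D hϰ hp₀ hσ hc₀
    (κ := 6 + 2 * 𝔠.κ₀) (by linarith [𝔠.κ₀_pos]) hκσ
  refine ⟨b₁, fun b₀ hb => ?_⟩
  obtain ⟨C, hC, hcap⟩ := hb₁ b₀ hb
  refine ⟨C, hC, ?_⟩
  intro S k hk v hCv N _ hLN n hn Bv hBv hBne
  -- n08-d's zero-background capstone, per `(h, U)`: bent window, bijection, Gaussian bridge, box identity, (3.24) for `μ_K` at every `η ∈ (0,1]`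
  have hkit := fun h U => hcap N hLN n hn (Bv h U) (hBv h U) (hBne h U)
  choose Λ e hbridge hboxkit hE using hkit
  refine ⟨Λ, e, ?_⟩
  intro 𝔖 Φ H s Jw aw hΦ hμ hboxm hVm hbox hV hH hJΛ hA hBvv
  refine h324Row_freeLetter_of_postConsumer_ae 𝔊 𝔠 𝔖 k (b₀ := b₀) (p₀ := p₀) hC hCv
    (fun h U => gaussianFieldOfKernel fun x y => if hxy : x ∈ Λ h U ∧ y ∈ Λ h U then
      ((Matrix.reindex (e h U) (e h U) ((elimTS LT (fun _ : Fin dT => N) (Bv h U) (hBv h U))ᵀ * reDelK n hn (fun _ : Fin dT => N) *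
        elimTS LT (fun _ : Fin dT => N) (Bv h U) (hBv h U)))⁻¹ : Matrix ↥(Λ h U) ↥(Λ h U) ℝ) ⟨x, hxy.1⟩ ⟨y, hxy.2⟩ else 0)
    (fun h U z => Φ h U (fun b => z ((e h U b : ↥(Λ h U)) : Fin (dT + dT + 1) → ℤ)))
    (fun h U => (hΦ h U).comp (measurable_restrictAlong (e h U))) (fun h U => ?_) hboxm hVm Λ (fun h U => ?_)
    (fun h U => hamiltonian s D ϰ (aw h U) (Jw h U)) (fun h U => ?_) ?_ (fun h U => ?_)
  · rw [hμ h U, ← hbridge h U, Measure.map_map (hΦ h U) (measurable_restrictAlong (e h U))]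
    rfl
  · have hq : Measure.QuasiMeasurePreserving (fun (z : (Fin (dT + dT + 1) → ℤ) → ℝ) (b : ↥(Bv h U)) => z ((e h U b : ↥(Λ h U)) : Fin (dT + dT + 1) → ℤ))
        (gaussianFieldOfKernel fun x y => if hxy : x ∈ Λ h U ∧ y ∈ Λ h U then
          ((Matrix.reindex (e h U) (e h U) ((elimTS LT (fun _ : Fin dT => N) (Bv h U) (hBv h U))ᵀ * reDelK n hn (fun _ : Fin dT => N) *
            elimTS LT (fun _ : Fin dT => N) (Bv h U) (hBv h U)))⁻¹ : Matrix ↥(Λ h U) ↥(Λ h U) ℝ) ⟨x, hxy.1⟩ ⟨y, hxy.2⟩ else 0)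
        (gaussianFieldOfKernel fun b b' =>
          ((((elimTS LT (fun _ : Fin dT => N) (Bv h U) (hBv h U))ᵀ * reDelK n hn (fun _ : Fin dT => N) *
            elimTS LT (fun _ : Fin dT => N) (Bv h U) (hBv h U)))⁻¹ : Matrix ↥(Bv h U) ↥(Bv h U) ℝ) b b') :=
      ⟨measurable_restrictAlong (e h U), by rw [hbridge h U]⟩
    have h1 := hq.preimage_ae_eq (hbox h U)
    rw [← Set.preimage_comp] at h1
    haveI : Nonempty ↥(Bv h U) := (hBne h U).coe_sort
    exact h1.trans (preimage_box_ae_eq_smallFieldSet_of_nonneg (e h U) _ (hboxkit h U) _)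
  · have h1 := ae_eq_comp (g := fun ω => (𝔖 k).𝒱 h U (Φ h U ω)) (g' := H h U) (measurable_restrictAlong (e h U)).aemeasurable
      (μ := gaussianFieldOfKernel fun x y => if hxy : x ∈ Λ h U ∧ y ∈ Λ h U then
          ((Matrix.reindex (e h U) (e h U) ((elimTS LT (fun _ : Fin dT => N) (Bv h U) (hBv h U))ᵀ * reDelK n hn (fun _ : Fin dT => N) *
            elimTS LT (fun _ : Fin dT => N) (Bv h U) (hBv h U)))⁻¹ : Matrix ↥(Λ h U) ↥(Λ h U) ℝ) ⟨x, hxy.1⟩ ⟨y, hxy.2⟩ else 0)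
      (by rw [hbridge h U]; exact hV h U)
    refine h1.trans (Filter.EventuallyEq.of_eq ?_)
    funext z
    exact hH h U z
  · intro h U
    have : (Λ h U).card = (Bv h U).card := by
      rw [← Fintype.card_coe, ← Fintype.card_coe]; exact (Fintype.card_congr (e h U)).symm
    rw [this]; exact hBvv h U
  · obtain ⟨b, hb⟩ := hBne h U
    exact hE h U (S.gk k) (gk_pos S k) (gk_le_one S S.gK_le_one k hk) s (Λ h U) (Jw h U) (aw h U) ⟨_, (e h U ⟨b, hb⟩).2⟩ (hJΛ h U) (hJΛ h U)
      (hA h U)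

/-! ## §2 THE PIPELINE FIRES: an UNCONDITIONAL instance of row `h324` in [B10] currencies at the printed zero-background member -/

/-- ★★★★★★ **THE (3.24) ROW OF THE (α) CLAUSE, UNCONDITIONALLY, AT THE PRINTED ZERO-BACKGROUND GAUGE-FIELD FLUCTUATION GAUSSIAN.**  For every `d_T ≥ 2`, `L_T ≥ 1` and the
(3.24) letters (`s`, `D`, `ϰ > 0`, `p₀ > 2∕3`, `σ > 0`, `c₀ ≥ 0`, `6 + 2κ₀ < σ(n̄ + 1)`): `∃ b₁, ∀ b₀ > b₁, ∃ C ≥ 0` such that for EVERY lattice approximation `S`, EVERY run step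
`k ≤ K`, EVERY cubic torus `(ℤ∕N)^{d_T}` (`L_T ∣ N`), EVERY level `n ≥ 1`, EVERY nonempty sub-family `B ⊆ B′` of the free bond variables under the budget `C·|B| ≤ (Ca + Cc)·|T₁^{(k)}|`,
there are a bent window `Λ ⊂ ℤ^{2d_T+1}` and `e : B ≃ Λ` such that for EVERY (4.5)-polynomial `H^{a}_{J}` on the window (`J ⊆ Λ`, `sup|coeff| ≤ c₀ g_k^σ`), read on the block through
`e` (coordinates off `Λ` set to `0`):
`Eq324 (∫_{{|ω_b| ≤ p(g_k) ∀ b}} e^{H(ω)} d𝒩(0,(C_Bᵀ·Re Δ_k·C_B)⁻¹)) (free cumulants of H) n̄ (Ca + Cc) (Lᵏg₀²) (3 + κ₀) |T₁^{(k)}|` — which is, character for character, the field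
`StepAlphaEq324CoreLTAtAC.h324` at the free letter for the tower datum whose step block is `((B → ℝ), 𝒩(0,(C_Bᵀ·Re Δ_k·C_B)⁻¹), Πχ̂, H ∘ ext_e)` (other fields zero): the class
road ∘ the (α)-socket pipeline EXERCISED END TO END on a printed object of the [Balaban1984PropagatorsII] lineage, no hypothesis on the member, the presentation or the
Hamiltonian letters left — only the window `b₁ < b₀` and the budget.  (Proof: seat n08-d's capstone for `B` once; the literal tower datum; part 4's plug with `Φ := (z ↦ z ∘ e)`,
`v := |B|∕|T₁^{(k)}|`; the Hamiltonian row by `hamiltonian_congr_eqOn`.)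
[cite: Balaban1985UV3, (22) p.261 + (58) p.270 + (5) p.256; Balaban1984PropagatorsII, (2.152)–(2.157) pp.249–250; Balaban1982Higgs1, (3.24) p.616; BenfattoEtAl1978, Lemma p.152 + (4.5) (class form; ours)] -/
theorem eq324_torusGaugeDatum_allSteps {dT LT : ℕ} (hdT : 2 ≤ dT) (hLT : 1 ≤ LT)
    (s D : ℕ) {ϰ : ℝ} (hϰ : 0 < ϰ) {p₀ σ c₀ : ℝ} (hp₀ : 2 / 3 < p₀) (hσ : 0 < σ) (hc₀ : 0 ≤ c₀) (hκσ : 6 + 2 * 𝔠.κ₀ < σ * (𝔠.nbar + 1)) :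
    ∃ b₁ : ℝ, ∀ b₀ : ℝ, b₁ < b₀ → ∃ C : ℝ, 0 ≤ C ∧
      ∀ (S : Scales L) (k : ℕ), k ≤ S.K → ∀ (N : ℕ) [NeZero N], LT ∣ N → ∀ (n : ℕ) (hn : 1 ≤ n)
        (B : Finset (B4.Idx (pbox (fun _ : Fin dT => N)) dT)) (hB : B ⊆ freeT LT (fun _ : Fin dT => N)), B.Nonempty →
        C * B.card ≤ (𝔠.Ca + 𝔠.Cc) * S.sites k →
        ∃ (Λ : Finset (Fin (dT + dT + 1) → ℤ)) (e : ↥B ≃ ↥Λ),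
          ∀ (J : Finset (Fin (dT + dT + 1) → ℤ)) (a : Coef (dT + dT + 1)), J ⊆ Λ → coefSup s D a J ≤ c₀ * S.gk k ^ σ →
            Eq324 (∫ ω in {ω : ↥B → ℝ | ∀ b, |ω b| ≤ B10.pFun b₀ p₀ (S.gk k)},
                Real.exp (hamiltonian s D ϰ a J (fun x => if hx : x ∈ Λ then ω (e.symm ⟨x, hx⟩) else (0 : ℝ)))
                ∂gaussianFieldOfKernel fun b b' =>
                  ((((elimTS LT (fun _ : Fin dT => N) B hB)ᵀ * reDelK n hn (fun _ : Fin dT => N) * elimTS LT (fun _ : Fin dT => N) B hB))⁻¹ :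
                    Matrix ↥B ↥B ℝ) b b')
              (fun m' => cumulantOf (fun m => ∫ ω, hamiltonian s D ϰ a J (fun x => if hx : x ∈ Λ then ω (e.symm ⟨x, hx⟩) else (0 : ℝ)) ^ m
                ∂gaussianFieldOfKernel fun b b' =>
                  ((((elimTS LT (fun _ : Fin dT => N) B hB)ᵀ * reDelK n hn (fun _ : Fin dT => N) * elimTS LT (fun _ : Fin dT => N) B hB))⁻¹ :
                    Matrix ↥B ↥B ℝ) b b') m')
              𝔠.nbar (𝔠.Ca + 𝔠.Cc) ((L : ℝ) ^ k * S.g0sq) (3 + 𝔠.κ₀) (S.sites k) := by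
  obtain ⟨b₁, hb₁⟩ := eq324_torusGaugeFluctuationSub_on_unit (d := dT) (L := LT) hdT hLT 𝔠.nbar D hϰ hp₀ hσ hc₀
    (κ := 6 + 2 * 𝔠.κ₀) (by linarith [𝔠.κ₀_pos]) hκσ
  refine ⟨b₁, fun b₀ hb => ?_⟩
  obtain ⟨C, hC, hcap⟩ := hb₁ b₀ hb
  refine ⟨C, hC, ?_⟩
  intro S k hk N _ hLN n hn B hB hBne hbudget
  obtain ⟨Λ, e, hbridge, hboxkit, hE⟩ := hcap N hLN n hn B hB hBne
  refine ⟨Λ, e, fun J a hJΛ hA => ?_⟩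
  haveI : Nonempty ↥B := hBne.coe_sort
  -- the extension by zero off the window, read back through `e`: agrees with `z` on `Λ ⊇ J`
  have hext : ∀ z : (Fin (dT + dT + 1) → ℤ) → ℝ,
      hamiltonian s D ϰ a J (fun x => if hx : x ∈ Λ then (fun b : ↥B => z ((e b : ↥Λ) : Fin (dT + dT + 1) → ℤ)) (e.symm ⟨x, hx⟩) else (0 : ℝ)) =
        hamiltonian s D ϰ a J z := fun z =>
    hamiltonian_congr_eqOn J fun x hx => by
      simp only [dif_pos (hJΛ hx), Equiv.apply_symm_apply, Subtype.coe_mk]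
  have hcoord : ∀ x : Fin (dT + dT + 1) → ℤ, Measurable fun ω : ↥B → ℝ => (if hx : x ∈ Λ then ω (e.symm ⟨x, hx⟩) else (0 : ℝ)) := fun x => by
    by_cases hx : x ∈ Λ
    · simp only [dif_pos hx]; exact measurable_pi_apply _
    · simp only [dif_neg hx]; exact measurable_const
  -- measurability of the potential read through `e` (the polynomial (4.5) unfolded; a lemma-level `Measurable.comp` is avoided on purpose — it is slow to unify here)
  have hVm : Measurable fun ω : ↥B → ℝ => hamiltonian s D ϰ a J (fun x => if hx : x ∈ Λ then ω (e.symm ⟨x, hx⟩) else (0 : ℝ)) := by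
    unfold hamiltonian
    refine Finset.measurable_sum _ fun p _ => Finset.measurable_sum _ fun Δ _ => Finset.measurable_sum _ fun n _ => ?_
    exact measurable_const.mul (Finset.measurable_prod _ fun i _ => (hcoord _).pow_const _)
  have hboxm : MeasurableSet {ω : ↥B → ℝ | ∀ b, |ω b| ≤ B10.pFun b₀ p₀ (S.gk k)} := by
    have : {ω : ↥B → ℝ | ∀ b, |ω b| ≤ B10.pFun b₀ p₀ (S.gk k)} = ⋂ b, {ω | |ω b| ≤ B10.pFun b₀ p₀ (S.gk k)} := by
      ext ω; simp only [Set.mem_setOf_eq, Set.mem_iInter]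
    rw [this]
    exact MeasurableSet.iInter fun b => measurableSet_le (continuous_abs.measurable.comp (measurable_pi_apply b)) measurable_const
  -- the budget: `v := |B| ∕ |T₁^{(k)}|`
  have hsites := sites_pos S k
  have hCv : C * ((B.card : ℝ) / S.sites k) ≤ 𝔠.Ca + 𝔠.Cc := by
    rw [← mul_div_assoc, div_le_iff₀ hsites]; exact hbudget
  -- the literal tower datum: block `((B → ℝ), 𝒩(0,(C_Bᵀ·Re Δ_k·C_B)⁻¹), Πχ̂_{p(g_k)}, H ∘ ext_e)`, every other field zero ∕ empty; part 4's plug at it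
  have key := h324Row_freeLetter_of_postConsumer_ae 𝔊 𝔠 (S := S) (fun k' => (
    { Ψ := fun _ _ => 0, Bcfg := fun _ _ _ => 0, far := fun _ _ _ => 0, PY := fun _ _ => 0, PYZ := fun _ _ => 0,
      Gt := fun _ => { Γ := PEmpty, supp := ∅, E := fun γ _ => γ.elim, loc := fun γ => γ.elim, nv := fun γ => γ.elim,
                       pref := fun γ => γ.elim, lines := fun γ => γ.elim },
      Ndeg := fun _ => 0, oldVal := fun _ _ _ _ _ _ => 0,
      Fl := ↥B → ℝ,
      μ := gaussianFieldOfKernel fun b b' =>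
        ((((elimTS LT (fun _ : Fin dT => N) B hB)ᵀ * reDelK n hn (fun _ : Fin dT => N) * elimTS LT (fun _ : Fin dT => N) B hB))⁻¹ : Matrix ↥B ↥B ℝ) b b',
      box := fun _ => {ω : ↥B → ℝ | ∀ b, |ω b| ≤ B10.pFun b₀ p₀ (S.gk k)},
      𝒱 := fun _ _ ω => hamiltonian s D ϰ a J (fun x => if hx : x ∈ Λ then ω (e.symm ⟨x, hx⟩) else (0 : ℝ)),
      dimZ := fun _ => 0, QU := fun _ _ => 0, JU := fun _ _ => 0, Q1 := fun _ => 0, J1 := fun _ => 0, dimT := 0, QT := 0, JT := 0 } : StepSeries S G ↥(lieC 𝔊) (nblkOf S 𝔠.lane.carrier k') k')) k (b₀ := b₀) (p₀ := p₀) hC hCv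
    (fun _ _ => gaussianFieldOfKernel fun x y => if hxy : x ∈ Λ ∧ y ∈ Λ then
      ((Matrix.reindex e e ((elimTS LT (fun _ : Fin dT => N) B hB)ᵀ * reDelK n hn (fun _ : Fin dT => N) * elimTS LT (fun _ : Fin dT => N) B hB))⁻¹ :
        Matrix ↥Λ ↥Λ ℝ) ⟨x, hxy.1⟩ ⟨y, hxy.2⟩ else 0)
    (fun _ _ z b => z ((e b : ↥Λ) : Fin (dT + dT + 1) → ℤ)) (fun _ _ => measurable_restrictAlong e) (fun _ _ => (hbridge).symm)
    (fun _ => hboxm) (fun _ _ => hVm) (fun _ _ => Λ)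
    (fun _ _ => preimage_box_ae_eq_smallFieldSet_of_nonneg e _ hboxkit _)
    (fun _ _ => hamiltonian s D ϰ a J) (fun _ _ => Filter.EventuallyEq.of_eq (funext fun z => hext z))
    (fun _ _ => by
      have : (Λ.card : ℝ) = B.card := by rw [← Fintype.card_coe, ← Fintype.card_coe]; exact_mod_cast (Fintype.card_congr e).symm
      rw [this, div_mul_cancel₀ _ hsites.ne'])
    (fun _ _ => hE (S.gk k) (gk_pos S k) (gk_le_one S S.gK_le_one k hk) s Λ J a ⟨_, (e (Classical.arbitrary ↥B)).2⟩ hJΛ hJΛ hA)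
  exact key (fun _ => ∅) (fun _ => 1)

end Summit.QuantumFields.YangMills.Theorems.BalabanUVNodesN08AlphaEq324RowClassSocketEndTorusGauge

end
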